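import Summits.BirchSwinnertonDyer.BirchSwinnertonDyer.Theorems.PrintCf2RubinValueTwoLinePinLineTrivial
import Summits.BirchSwinnertonDyer.BirchSwinnertonDyer.Theorems.PrintCf2RubinValueTwoLinePinExponentPin
import Summits.BirchSwinnertonDyer.BirchSwinnertonDyer.Theorems.PrintCf2RubinValueTwoLinePinSlotOneIdentityInnerSpec
import Summits.BirchSwinnertonDyer.BirchSwinnertonDyer.Theorems.PrintCf2RubinValueTwoLinePinInnerSpecializationOfXRegular
import HarnessLib

/-!
# M-LINE-PIN, the `T`-TYPE BRANCHES — THE JUNCTION in socket currency: (Q) + (M₀) + (A₀) + slot-1 control ⟹ `a = b` ∧ `(ch_{Λ₂} D₂.X)^J = (G₂)` for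
# characters trivial on `Gal(K̄/K_∞)` (no Euler exponent to pin, no (LS)_v); generic and ON THE CLASS FRAME

Cell `bsd-print-cf2`, WIDTH seat `bsd-line-cf2-p1-w5` g8 (prover-bsd-line-cf2-p1-w5-g8-0); sequel of `…LinePinThetaOne` (p704807) and `…LinePinLineTrivial`.
Helper, Theses-free, `--supports` the M-LINE-PIN item (planner wording). HONEST FRAMING: ONE socket application (cf2c-w8 g3's p695043
`LinePin.map_charIdeal_eq_span_of_powForm_of_firstLine`); the two analytic/print inputs of the `T`-type rows are DISPLAYED hypotheses:
(M₀) the one-variable [MC] on the `v`-line — `D₁.X` torsion with `(ch_Λ D₁.X)^J = (G₁)`, `G₁ ≠ 0` (for `θ = 1`: ty2 g35's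
`Muller2020.thm13_trivialChar_exists_nuPseudoBranch_charIdeal_eq` = Müller 2020 Thm. 1.1/1.3 at `χ = 1` on the MEASURE `(1−γ)ν(1)`, Def. 2.5; p705308 in
review at the time of writing; for `θ = χ_v`: not typed) and (A₀) `(G₂(T₁,0)) = (G₁)` — the EXPECTED restriction identity of de Shalit II.4.12 at a `T`-type
branch on an undecomposed `v̄` (ty2 g35 07:16:29Z: «(1 − (1+T)⁻¹)·π_v(G₂) ∼ E_v̄·G, E_v̄ = 1 − (1+T)^{κ(Frob_v̄)} ∈ T·Λˣ ⇒ span{π_v(G₂)} = span{G}»);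
nothing analytic is proved here and the existence of an integral `G₂` at `θ = 1`, `S = ∅` is not discussed; no summit statement is proved by this seat;
BSD is not proved by any of this. THEOREMS ONLY (no definition, no named fact, no `sorry`).

* §1 `map_constantCoeff_charIdeal_ne_bot_of_powForm_of_span_eq` — `(ch D₂.X)(T₁,0) ≠ 0` for free from (Q), (A₀), `G₁ ≠ 0` (cf2c-w8 g4's lemma with
  the Euler factor absorbed); `map_charIdeal_eq_span_of_powForm_of_kerTrivial` — the `T`-type twin of cf2c-w8 g4's part 8
  `zpCorank_eq_one_and_map_charIdeal_eq_span_of_powForm`: `hline` PRODUCED from `…LinePinLineTrivial.charIdeal_map_eq_charIdeal_of_kerTrivial`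
  (`π(ch D₂.X) = ch D₁.X`) + (M₀) + (A₀); torsion of `D₂.X` from `D₁.X` by cf2c-w2 g4's `LinePinDefect.isTorsion₂_of_slotOne_control_of_decomp`.
* §2 `map_charIdeal_eq_span_of_powForm_charModule_of_frame_of_kerTrivial` — §1 on the class frame (`θ_K² = −7`, `C • W = cm7^{(d)}`, `κ₁` THE `v`-line,
  `κ₂` the `v̄`-line, `γ₂ ∈ I_v̄`; `θ² = 1` with `θ σ = 1` on `ker κ₁`): 24086's clause at the `T`-type rows modulo (Q), (M₀), (A₀), (R).
JUNK TERM: S3n′ is NOT used — the inner specialisation is fed by INNER `T₂`-REGULARITY `hX` (LEAD g14's (R) `stub_xRegularInner`) through (C4′)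
p704959 and this seat's (C5′) `…SlotOneIdentityInnerSpec` (§0: `charIdeal_map_eq_charIdeal_of_kerTrivial_of_innerSpec` / `…_of_xRegularInner`).
presearch: Müller 2020 Def. 2.5 / Cor. 4.3 for the `χ = 1` normalisation [corpus: paper:arxiv-2002.05647 p0006–p0007, p0015]; otherwise as in
`…LinePinThetaOne`. beyond-print theorem: no.

References: [Mueller2020MCSplitTwo] Thm. 1.1, Def. 2.5, Cor. 4.3; [deShalit1987] II.4.12; [GreenbergLNM1716] §3–4; [Washington1997] §13.1–13.2.
-/

noncomputable section

open scoped Classical Pointwise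

-- the summit namespace `Summit.BirchSwinnertonDyer.BirchSwinnertonDyer` repeats the problem name by design (D-0017)
set_option linter.dupNamespace false
set_option autoImplicit false

open NumberField IsDedekindDomain Field Literature.NumberTheory.GaloisRepresentations
  Literature.NumberTheory.EllipticCurves Literature.NumberTheory.EllipticCurves.GreenbergSelmer
  Literature.NumberTheory.EllipticCurves.GreenbergVatsal2000 Literature.NumberTheory.EllipticCurves.KellerYin2024
  Literature.NumberTheory.EllipticCurves.IwasawaDual Literature.NumberTheory.EllipticCurves.Module
  Summit.BirchSwinnertonDyer.BirchSwinnertonDyer.Theorems.PrintCf2.LinePinControl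
  Summit.BirchSwinnertonDyer.BirchSwinnertonDyer.Theorems.PrintCf2.LinePin

namespace Summit.BirchSwinnertonDyer.BirchSwinnertonDyer.Theorems.PrintCf2.LinePinThetaOne


/-! ## §0. The `v`-line identity WITHOUT defect, inner specialisation displayed (`hC4`) or from inner `T₂`-regularity (`hX`) — no S3n′ -/

section InnerSpec

variable {K : Type} [Field K] [NumberField K] {p : ℕ} [Fact p.Prime] {κ κ₂ : ZpExtension K p}
  {M : Type} [AddCommGroup M] [DistribMulAction (absoluteGaloisGroup K) M] [TopologicalSpace M] [DiscreteTopology M]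
  {𝔮 : HeightOneSpectrum (𝓞 K)} {γ γ₂ : absoluteGaloisGroup K}
  {g : unrSelmer κ M 𝔮 ∅ →+ unrSelmer₂ κ κ₂ M 𝔮}
  (hg : ∀ t : unrSelmer κ M 𝔮 ∅,
    ((g t : unrSelmer₂ κ κ₂ M 𝔮) : subgroupH1 (ZpExtension.pairKer κ κ₂) M) =
      resOfLe M (ZpExtension.pairKer_le_left κ κ₂) (t : subgroupH1 κ.kerSubgroup M))
  {D₂ : DualData₂ κ κ₂ M 𝔮 γ γ₂} {D₁ : DatumDualData κ γ M (Castella2018.AcSelmer.bdpData M p 𝔮) ∅}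
  {φ : D₂.X →ₛₗ[PowerSeries.map (PowerSeries.constantCoeff (R := ℤ_[p]))] D₁.X}
  (hφ : ∀ (x : D₂.X) (t : unrSelmer κ M 𝔮 ∅), D₁.toDual (φ x) t = D₂.toDual x (g t))
include hg hφ

/-- **`π_v(charIdeal Λ₂ D₂.X) = charIdeal Λ D₁.X` for `M` trivial on `ker κ`, inner specialisation DISPLAYED** (`hC4`, fed by S3n′ via (C4) or by inner
`T₂`-regularity via (C4′)): (C5′) `charIdeal_map_eq_mul_of_slotOne_control_of_innerSpec` + `…LinePinLineTrivial.ker_liftQ_eq_bot_of_kerTrivial`.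
[cite: GreenbergLNM1716, §3–4] [cite: Washington1997, §13.2] -/
theorem charIdeal_map_eq_charIdeal_of_kerTrivial_of_innerSpec [Module.Finite (IwasawaAlgebra₂ p) D₂.X]
    (hγ : ZpExtension.IsTopGeneratorPair κ κ₂ γ γ₂)
    (hcont : ∀ m : M, Continuous fun σ : absoluteGaloisGroup K ↦ σ • m)
    (hker : ∀ σ : absoluteGaloisGroup K, σ ∈ κ.kerSubgroup → ∀ m : M, σ • m = m) (hprim : ∀ m : M, ∃ k : ℕ, p ^ k • m = 0)
    (hκ₂ : κ₂.IsUnramifiedOutside 𝔮) (h𝔮 : ((p : ℕ) : 𝓞 K) ∈ 𝔮.asIdeal) (hIκ : inertia 𝔮 ≤ κ.kerSubgroup)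
    (htot : ∀ z : Multiplicative ℤ_[p], ∃ τ ∈ inertia 𝔮, κ₂ τ = z)
    {τ₀ : absoluteGaloisGroup K} (hτ₀ : τ₀ ∈ decomp 𝔮) (hκτ₀ : κ τ₀ = κ γ)
    (htors : Module.IsTorsion (IwasawaAlgebra₂ p) D₂.X)
    (hne : (charIdeal (IwasawaAlgebra₂ p) D₂.X).map (PowerSeries.map (PowerSeries.constantCoeff (R := ℤ_[p]))) ≠ ⊥)
    (hC4 : letI : Module (IwasawaAlgebra p) (QuotSMulTop (PowerSeries.C (PowerSeries.X : IwasawaAlgebra p) : IwasawaAlgebra₂ p) D₂.X) :=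
        Module.compHom _ (PowerSeries.map (PowerSeries.C (R := ℤ_[p])))
      (charIdeal (IwasawaAlgebra₂ p) D₂.X).map (PowerSeries.map (PowerSeries.constantCoeff (R := ℤ_[p]))) =
        charIdeal (IwasawaAlgebra p) (QuotSMulTop (PowerSeries.C (PowerSeries.X : IwasawaAlgebra p) : IwasawaAlgebra₂ p) D₂.X)) :
    (charIdeal (IwasawaAlgebra₂ p) D₂.X).map (PowerSeries.map (PowerSeries.constantCoeff (R := ℤ_[p]))) =
      charIdeal (IwasawaAlgebra p) D₁.X := by
  haveI : Finite g.ker :=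
    finite_ker_lineRes_unr_of_inertia hg h𝔮 (fun τ hτ m ↦ hker τ (hIκ hτ) m) hIκ (fun σ _ ↦ htot (κ₂ σ))
  letI instQ : Module (IwasawaAlgebra p) (QuotSMulTop (PowerSeries.C (PowerSeries.X : IwasawaAlgebra p) : IwasawaAlgebra₂ p) D₂.X) :=
    Module.compHom _ (PowerSeries.map (PowerSeries.C (R := ℤ_[p])))
  obtain ⟨φbar, hφbar, hmul, -⟩ := charIdeal_map_eq_mul_of_slotOne_control_of_innerSpec hg hφ htors hne hC4
  have hkerφ : LinearMap.ker φbar = ⊥ :=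
    ker_liftQ_eq_bot_of_kerTrivial hg hφ hγ hcont hker hprim hκ₂ h𝔮 hIκ htot hτ₀ hκτ₀ φbar hφbar
  have htop : charIdeal (IwasawaAlgebra p) (LinearMap.ker φbar) = ⊤ := by
    haveI : Subsingleton (LinearMap.ker φbar) := by
      rw [hkerφ]
      infer_instance
    exact charIdeal_eq_top_of_isPseudoNull (isPseudoNull_of_subsingleton _ _)
  rw [hmul, htop, Ideal.top_mul]

/-- **… from INNER `T₂`-REGULARITY** (`hX : (C X) • x = 0 → x = 0`, LEAD g14's (R) `stub_xRegularInner`), via (C4′) p704959. [cite: Washington1997, §13.2] -/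
theorem charIdeal_map_eq_charIdeal_of_kerTrivial_of_xRegularInner [Module.Finite (IwasawaAlgebra₂ p) D₂.X]
    (hγ : ZpExtension.IsTopGeneratorPair κ κ₂ γ γ₂)
    (hcont : ∀ m : M, Continuous fun σ : absoluteGaloisGroup K ↦ σ • m)
    (hker : ∀ σ : absoluteGaloisGroup K, σ ∈ κ.kerSubgroup → ∀ m : M, σ • m = m) (hprim : ∀ m : M, ∃ k : ℕ, p ^ k • m = 0)
    (hκ₂ : κ₂.IsUnramifiedOutside 𝔮) (h𝔮 : ((p : ℕ) : 𝓞 K) ∈ 𝔮.asIdeal) (hIκ : inertia 𝔮 ≤ κ.kerSubgroup)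
    (htot : ∀ z : Multiplicative ℤ_[p], ∃ τ ∈ inertia 𝔮, κ₂ τ = z)
    {τ₀ : absoluteGaloisGroup K} (hτ₀ : τ₀ ∈ decomp 𝔮) (hκτ₀ : κ τ₀ = κ γ)
    (htors : Module.IsTorsion (IwasawaAlgebra₂ p) D₂.X)
    (hne : (charIdeal (IwasawaAlgebra₂ p) D₂.X).map (PowerSeries.map (PowerSeries.constantCoeff (R := ℤ_[p]))) ≠ ⊥)
    (hX : ∀ x : D₂.X, (PowerSeries.C (PowerSeries.X : IwasawaAlgebra p) : IwasawaAlgebra₂ p) • x = 0 → x = 0) :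
    (charIdeal (IwasawaAlgebra₂ p) D₂.X).map (PowerSeries.map (PowerSeries.constantCoeff (R := ℤ_[p]))) =
      charIdeal (IwasawaAlgebra p) D₁.X :=
  charIdeal_map_eq_charIdeal_of_kerTrivial_of_innerSpec hg hφ hγ hcont hker hprim hκ₂ h𝔮 hIκ htot hτ₀ hκτ₀ htors hne
    (map_mapConstantCoeff_charIdeal_eq_of_xRegularInner_of_ne_bot D₂ htors hne hX)

end InnerSpec

/-! ## §1. The junction for `M` trivial on `ker κ` (generic `K`, `𝔮 ∣ p` undecomposed and totally ramified for the partner) -/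

section Junction

open Summit.BirchSwinnertonDyer.BirchSwinnertonDyer.Theorems.PrintCf2.LinePin

variable {K : Type} [Field K] [NumberField K] {p : ℕ} [Fact p.Prime] {κ κ₂ : ZpExtension K p}
  {M : Type} [AddCommGroup M] [DistribMulAction (absoluteGaloisGroup K) M] [TopologicalSpace M] [DiscreteTopology M]
  {𝔮 : HeightOneSpectrum (𝓞 K)} {γ γ₂ : absoluteGaloisGroup K}
  {g : unrSelmer κ M 𝔮 ∅ →+ unrSelmer₂ κ κ₂ M 𝔮}
  (hg : ∀ t : unrSelmer κ M 𝔮 ∅,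
    ((g t : unrSelmer₂ κ κ₂ M 𝔮) : subgroupH1 (ZpExtension.pairKer κ κ₂) M) =
      resOfLe M (ZpExtension.pairKer_le_left κ κ₂) (t : subgroupH1 κ.kerSubgroup M))
  {D₂ : DualData₂ κ κ₂ M 𝔮 γ γ₂} {D₁ : DatumDualData κ γ M (Castella2018.AcSelmer.bdpData M p 𝔮) ∅}
  {φ : D₂.X →ₛₗ[PowerSeries.map (PowerSeries.constantCoeff (R := ℤ_[p]))] D₁.X}
  (hφ : ∀ (x : D₂.X) (t : unrSelmer κ M 𝔮 ∅), D₁.toDual (φ x) t = D₂.toDual x (g t))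

/-- **`(ch_{Λ₂} D.X)(T₁,0) ≠ 0` FOR FREE at a `T`-type branch** from (Q), (A₀) `(G₂(T₁,0)) = (G₁)` and `G₁ ≠ 0` (cf2c-w8 g4's
`map_constantCoeff_charIdeal_ne_bot_of_powForm` with the Euler factor absorbed). [cite: Washington1997, §13.2 (shape only)] -/
theorem map_constantCoeff_charIdeal_ne_bot_of_powForm_of_span_eq (D : DualData₂ κ κ₂ M 𝔮 γ γ₂)
    (J : ℤ_[p] →+* PadicComplexInt p) (G₂ : PowerSeries (PowerSeries (PadicComplexInt p)))
    (F : IwasawaAlgebra₂ p) (hF : charIdeal (IwasawaAlgebra₂ p) D.X = Ideal.span {F})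
    {a b : ℕ} (hQ : Ideal.span ({((p : ℕ) : PowerSeries (PowerSeries (PadicComplexInt p))) ^ a *
        PowerSeries.map (PowerSeries.map J) F} : Set (PowerSeries (PowerSeries (PadicComplexInt p)))) =
      Ideal.span {((p : ℕ) : PowerSeries (PowerSeries (PadicComplexInt p))) ^ b * G₂})
    (G₁ : PowerSeries (PadicComplexInt p)) (hG₁ : G₁ ≠ 0)
    (hA : Ideal.span ({PowerSeries.map (PowerSeries.constantCoeff (R := PadicComplexInt p)) G₂} : Set (PowerSeries (PadicComplexInt p))) =
      Ideal.span {G₁}) :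
    (charIdeal (IwasawaAlgebra₂ p) D.X).map (PowerSeries.map (PowerSeries.constantCoeff (R := ℤ_[p]))) ≠ ⊥ := by
  have hp0 : ((p : ℕ) : PadicComplexInt p) ≠ 0 := natCast_prime_padicComplexInt_ne_zero (p := p)
  have hk := span_C_pow_mul_line_eq_of_powForm J G₂ F hQ
  have hg0 : PowerSeries.map (PowerSeries.constantCoeff (R := PadicComplexInt p)) G₂ ≠ 0 :=
    (Ideal.span_singleton_eq_span_singleton.mp hA).ne_zero_iff.mpr hG₁
  have hka := Ideal.span_singleton_eq_span_singleton.mp hk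
  have hCb : PowerSeries.C (((p : ℕ) : PadicComplexInt p) ^ b) ≠ 0 := fun h ↦
    pow_ne_zero b hp0 (PowerSeries.C_injective (h.trans (map_zero _).symm))
  have hf0 : PowerSeries.map J (PowerSeries.map (PowerSeries.constantCoeff (R := ℤ_[p])) F) ≠ 0 :=
    right_ne_zero_of_mul (hka.ne_zero_iff.mpr (mul_ne_zero hCb hg0))
  rw [hF, map_span_singleton, Ne, Ideal.span_singleton_eq_bot]
  intro h0
  exact hf0 (by rw [h0, map_zero])

include hg hφ

/-- **M-LINE-PIN ASSEMBLED ON THE FIRST SLOT AT A `T`-TYPE BRANCH: (Q) + (M₀) + (A₀) + control ⟹ `a = b` ∧ the two-variable clause.**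
`ker κ = Gal(K̄/K_∞)` acts trivially on `M` (continuous orbits); `κ₂` unramified outside `𝔮 ∣ p` and totally ramified there (`κ₂(I_𝔮) = ℤ_p`), `I_𝔮 ≤ ker κ`,
`𝔮` undecomposed in the line (`κ τ₀ = κ γ`, `τ₀ ∈ D_𝔮` acting on `M` as an integer `u`); `D₂.X` f.g. with INNER `T₂`-regularity (`hX`, no S3n′); (M₀) `D₁.X` TORSION with
`(ch_Λ D₁.X)^J = (G₁)`, `G₁ ≠ 0`; (Q) the ⊗ℚ-form `(p^a F^J) = (p^b G₂)` for a generator `F` of `ch_{Λ₂} D₂.X`; (A₀) `(G₂(T₁,0)) = (G₁)`. THEN `D₂.X` is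
torsion, `a = b` and **`(ch_{Λ₂} D₂.X).map (map (map J)) = (G₂)`** — the conclusion of the socket `map_charIdeal_eq_span_of_powForm_of_firstLine` with its
`hline` PRODUCED (`π(ch D₂.X) = ch D₁.X`, no defect, `…LinePinLineTrivial`). [cite: Washington1997, §13.2 (shape only)] [cite: deShalit1987, II.4.12]
[cite: Mueller2020MCSplitTwo, Thm. 1.1, Def. 2.5] [cite: GreenbergLNM1716, §3–4] -/
theorem map_charIdeal_eq_span_of_powForm_of_kerTrivial [Module.Finite (IwasawaAlgebra₂ p) D₂.X]
    (hγ : ZpExtension.IsTopGeneratorPair κ κ₂ γ γ₂)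
    (hcont : ∀ m : M, Continuous fun σ : absoluteGaloisGroup K ↦ σ • m)
    (hker : ∀ σ : absoluteGaloisGroup K, σ ∈ κ.kerSubgroup → ∀ m : M, σ • m = m) (hprim : ∀ m : M, ∃ k : ℕ, p ^ k • m = 0)
    (hκ₂ : κ₂.IsUnramifiedOutside 𝔮) (h𝔮 : ((p : ℕ) : 𝓞 K) ∈ 𝔮.asIdeal) (hIκ : inertia 𝔮 ≤ κ.kerSubgroup)
    (htot : ∀ z : Multiplicative ℤ_[p], ∃ τ ∈ inertia 𝔮, κ₂ τ = z)
    {τ₀ : absoluteGaloisGroup K} (hτ₀ : τ₀ ∈ decomp 𝔮) (hκτ₀ : κ τ₀ = κ γ) {u : ℤ} (hu : ∀ m : M, τ₀ • m = u • m)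
    (hD₁ : Module.IsTorsion (IwasawaAlgebra p) D₁.X)
    (hX : ∀ x : D₂.X, (PowerSeries.C (PowerSeries.X : IwasawaAlgebra p) : IwasawaAlgebra₂ p) • x = 0 → x = 0)
    (J : ℤ_[p] →+* PadicComplexInt p) (G₂ : PowerSeries (PowerSeries (PadicComplexInt p)))
    (F : IwasawaAlgebra₂ p) (hF : charIdeal (IwasawaAlgebra₂ p) D₂.X = Ideal.span {F})
    {a b : ℕ} (hQ : Ideal.span ({((p : ℕ) : PowerSeries (PowerSeries (PadicComplexInt p))) ^ a *
        PowerSeries.map (PowerSeries.map J) F} : Set (PowerSeries (PowerSeries (PadicComplexInt p)))) =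
      Ideal.span {((p : ℕ) : PowerSeries (PowerSeries (PadicComplexInt p))) ^ b * G₂})
    (G₁ : PowerSeries (PadicComplexInt p)) (hG₁ : G₁ ≠ 0)
    (hM : (charIdeal (IwasawaAlgebra p) D₁.X).map (PowerSeries.map J) = Ideal.span {G₁})
    (hA : Ideal.span ({PowerSeries.map (PowerSeries.constantCoeff (R := PadicComplexInt p)) G₂} : Set (PowerSeries (PadicComplexInt p))) =
      Ideal.span {G₁}) :
    Module.IsTorsion (IwasawaAlgebra₂ p) D₂.X ∧ a = b ∧
      (charIdeal (IwasawaAlgebra₂ p) D₂.X).map (PowerSeries.map (PowerSeries.map J)) = Ideal.span {G₂} := by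
  -- torsion of `D₂.X` from the one-variable torsion (cf2c-w2 g4)
  have htors : Module.IsTorsion (IwasawaAlgebra₂ p) D₂.X :=
    LinePinDefect.isTorsion₂_of_slotOne_control_of_decomp hg hφ hγ hcont hprim hκ₂ h𝔮
      (fun y hy _ m ↦ hker y (ZpExtension.pairKer_le_left κ κ₂ hy) m) hτ₀ one_ne_zero (by rw [pow_one]; exact hκτ₀) hu hD₁
  have hne : (charIdeal (IwasawaAlgebra₂ p) D₂.X).map (PowerSeries.map (PowerSeries.constantCoeff (R := ℤ_[p]))) ≠ ⊥ :=
    map_constantCoeff_charIdeal_ne_bot_of_powForm_of_span_eq D₂ J G₂ F hF hQ G₁ hG₁ hA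
  -- the `v`-line identity WITHOUT defect
  have hid := charIdeal_map_eq_charIdeal_of_kerTrivial_of_xRegularInner hg hφ hγ hcont hker hprim hκ₂ h𝔮 hIκ htot hτ₀ hκτ₀ htors hne hX
  -- `hline` of the socket: `((F(T₁,0))^J) = ((ch D₁.X)^J) = (G₁) = (G₂(T₁,0))`
  have hf : Ideal.span ({PowerSeries.map J (PowerSeries.map (PowerSeries.constantCoeff (R := ℤ_[p])) F)} :
        Set (PowerSeries (PadicComplexInt p))) = Ideal.span {G₁} := by
    have h := congrArg (Ideal.map (PowerSeries.map J)) hid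
    rw [hF, map_span_singleton, map_span_singleton, hM] at h
    exact h
  have hline : Ideal.span ({PowerSeries.map J (PowerSeries.map (PowerSeries.constantCoeff (R := ℤ_[p])) F)} :
        Set (PowerSeries (PadicComplexInt p))) =
      Ideal.span {PowerSeries.map (PowerSeries.constantCoeff (R := PadicComplexInt p)) G₂} := hf.trans hA.symm
  have hF0 : PowerSeries.map J (PowerSeries.map (PowerSeries.constantCoeff (R := ℤ_[p])) F) ≠ 0 :=
    (Ideal.span_singleton_eq_span_singleton.mp hf).ne_zero_iff.mpr hG₁
  exact ⟨htors, map_charIdeal_eq_span_of_powForm_of_firstLine D₂ J G₂ F hF hQ hline hF0⟩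

end Junction

/-! ## §2. The junction ON THE CLASS FRAME (`θ` trivial on `ker κ₁`): displayed inputs = (Q), (M₀), (A₀), S3n′ -/

section JunctionFrame

open WeierstrassCurve Summit.BirchSwinnertonDyer.BirchSwinnertonDyer.Theorems.PrintCf2.LinePin

variable {K : Type} [Field K] [NumberField K]

/-- **M-LINE-PIN `T`-TYPE ROWS ON THE CLASS FRAME, JUNCTION FORM.** Road-α / DA frame (`θ_K² = −7`, `C • W = cm7^{(d)}`, `2 = v v̄`, `κ₁` THE `v`-line,
`κ₂` the `v̄`-line, generator pair with `γ₂ ∈ I_v̄`), a quadratic `θ` (`θ σ² = 1`) TRIVIAL ON `ker κ₁` (`θ = 1` or `χ_v`), the slot-1 control `g`/`φ` ((C1)),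
`D₂.X` f.g. with inner `T₂`-regularity (`hX`, (R)), and the three DISPLAYED inputs of the row: (Q) `(2^a F^J) = (2^b G₂)` for a generator `F` of `ch_{Λ₂} D₂.X`; (M₀) `D₁.X`
torsion with `(ch_Λ D₁.X)^J = (G₁)`, `G₁ ≠ 0`; (A₀) `(G₂(T₁,0)) = (G₁)`. THEN `D₂.X` is torsion, `a = b` and **`(ch_{Λ₂} D₂.X).map (map (map J)) = (G₂)`**
— 24086's clause at the `T`-type rows. No (LS)_v, no corank, no Euler exponent. [cite: Mueller2020MCSplitTwo, Thm. 1.1, Def. 2.5]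
[cite: deShalit1987, II.4.12] [cite: GreenbergLNM1716, §3–4] [cite: Washington1997, §13.1–13.2] -/
theorem map_charIdeal_eq_span_of_powForm_charModule_of_frame_of_kerTrivial (hK : IsImaginaryQuadratic K) {θK : K} (hθK : θK ^ 2 = -7)
    {d : ℤ} (hd0 : d ≠ 0) (W : WeierstrassCurve ℚ) [W.IsElliptic] {CW : VariableChange ℚ} (hCW : CW • W = cm7.quadraticTwist (d : ℚ))
    {v vbar : HeightOneSpectrum (𝓞 K)} (hv : ((2 : ℕ) : 𝓞 K) ∈ v.asIdeal) (hvbar : ((2 : ℕ) : 𝓞 K) ∈ vbar.asIdeal) (hne : vbar ≠ v)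
    {κ₁ κ₂ : ZpExtension K 2} (hκ₁ : κ₁.IsUnramifiedOutside v) (hκ₂ : κ₂.IsUnramifiedOutside vbar)
    {γ₁ γ₂ : absoluteGaloisGroup K} (hγ : ZpExtension.IsTopGeneratorPair κ₁ κ₂ γ₁ γ₂) (hγ₂I : γ₂ ∈ inertia vbar)
    (θ : FramedGaloisRep K (padicCoeffIntegers (∅ : Set (PadicAlgCl 2))) 1) (hθ2 : ∀ σ, θ σ ^ 2 = 1)
    (hθκ : ∀ σ : absoluteGaloisGroup K, σ ∈ κ₁.kerSubgroup → θ σ = 1)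
    {g : unrSelmer κ₁ (charModule (∅ : Set (PadicAlgCl 2)) θ) vbar ∅ →+ unrSelmer₂ κ₁ κ₂ (charModule (∅ : Set (PadicAlgCl 2)) θ) vbar}
    (hg : ∀ t : unrSelmer κ₁ (charModule (∅ : Set (PadicAlgCl 2)) θ) vbar ∅,
      ((g t : unrSelmer₂ κ₁ κ₂ (charModule (∅ : Set (PadicAlgCl 2)) θ) vbar) :
          subgroupH1 (ZpExtension.pairKer κ₁ κ₂) (charModule (∅ : Set (PadicAlgCl 2)) θ)) =
        resOfLe (charModule (∅ : Set (PadicAlgCl 2)) θ) (ZpExtension.pairKer_le_left κ₁ κ₂)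
          (t : subgroupH1 κ₁.kerSubgroup (charModule (∅ : Set (PadicAlgCl 2)) θ)))
    {D₂ : DualData₂ κ₁ κ₂ (charModule (∅ : Set (PadicAlgCl 2)) θ) vbar γ₁ γ₂} [Module.Finite (IwasawaAlgebra₂ 2) D₂.X]
    {D₁ : DatumDualData κ₁ γ₁ (charModule (∅ : Set (PadicAlgCl 2)) θ)
      (Castella2018.AcSelmer.bdpData (charModule (∅ : Set (PadicAlgCl 2)) θ) 2 vbar) ∅}
    {φ : D₂.X →ₛₗ[PowerSeries.map (PowerSeries.constantCoeff (R := ℤ_[2]))] D₁.X}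
    (hφ : ∀ (x : D₂.X) (t : unrSelmer κ₁ (charModule (∅ : Set (PadicAlgCl 2)) θ) vbar ∅), D₁.toDual (φ x) t = D₂.toDual x (g t))
    (hX : ∀ x : D₂.X, (PowerSeries.C (PowerSeries.X : IwasawaAlgebra 2) : IwasawaAlgebra₂ 2) • x = 0 → x = 0)
    (J : ℤ_[2] →+* PadicComplexInt 2) (G₂ : PowerSeries (PowerSeries (PadicComplexInt 2)))
    (F : IwasawaAlgebra₂ 2) (hF : charIdeal (IwasawaAlgebra₂ 2) D₂.X = Ideal.span {F})
    {a b : ℕ} (hQ : Ideal.span ({((2 : ℕ) : PowerSeries (PowerSeries (PadicComplexInt 2))) ^ a *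
        PowerSeries.map (PowerSeries.map J) F} : Set (PowerSeries (PowerSeries (PadicComplexInt 2)))) =
      Ideal.span {((2 : ℕ) : PowerSeries (PowerSeries (PadicComplexInt 2))) ^ b * G₂})
    (hD₁ : Module.IsTorsion (IwasawaAlgebra 2) D₁.X) (G₁ : PowerSeries (PadicComplexInt 2)) (hG₁ : G₁ ≠ 0)
    (hM : (charIdeal (IwasawaAlgebra 2) D₁.X).map (PowerSeries.map J) = Ideal.span {G₁})
    (hA : Ideal.span ({PowerSeries.map (PowerSeries.constantCoeff (R := PadicComplexInt 2)) G₂} : Set (PowerSeries (PadicComplexInt 2))) =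
      Ideal.span {G₁}) :
    Module.IsTorsion (IwasawaAlgebra₂ 2) D₂.X ∧ a = b ∧
      (charIdeal (IwasawaAlgebra₂ 2) D₂.X).map (PowerSeries.map (PowerSeries.map J)) = Ideal.span {G₂} := by
  obtain ⟨τ₀, hτ₀, hκτ₀⟩ := exists_mem_decomp_vbar_apply_eq_of_isUnramifiedOutside hK hθK hd0 W hCW hv hvbar hne κ₁ hκ₁ hγ.left
  obtain ⟨u, -, -, hu⟩ := exists_int_smul_charModule_of_sq_eq_one θ (hθ2 τ₀)
  have hcont : ∀ m : charModule (∅ : Set (PadicAlgCl 2)) θ, Continuous fun σ : absoluteGaloisGroup K ↦ σ • m :=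
    fun m ↦ CharResidualSelmerCount.continuous_smul_charModule θ m
  have hker : ∀ σ : absoluteGaloisGroup K, σ ∈ κ₁.kerSubgroup → ∀ m : charModule (∅ : Set (PadicAlgCl 2)) θ, σ • m = m :=
    fun σ hσ m ↦ CharLocalInertiaFrobenius.smul_eq_self_of_apply_eq_one θ (hθκ σ hσ) m
  have hprim : ∀ m : charModule (∅ : Set (PadicAlgCl 2)) θ, ∃ k : ℕ, 2 ^ k • m = 0 :=
    fun m ↦ exists_pow_smul_cofree_eq_zero (∅ : Set (PadicAlgCl 2)) θ m
  have hunit : IsUnit (κ₂ γ₂).toAdd := by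
    rw [hγ.right, toAdd_ofAdd]
    exact isUnit_one
  exact map_charIdeal_eq_span_of_powForm_of_kerTrivial hg hφ hγ hcont hker hprim hκ₂ hvbar (hκ₁.inertia_le hne)
    (forall_exists_inertia_apply_eq_of_isUnit' hγ₂I hunit) hτ₀ hκτ₀ hu hD₁ hX J G₂ F hF hQ G₁ hG₁ hM hA

end JunctionFrame

end Summit.BirchSwinnertonDyer.BirchSwinnertonDyer.Theorems.PrintCf2.LinePinThetaOne

end
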